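import Summits.HodgeConjecture.CorCM.MultiFieldWeilDihedralUnit
import HarnessLib

/-!
# MULTI-FIELD WEIL ENGINE — THE DIHEDRAL PENTAGON, FREENESS FROM SHARING: two DISTINCT `2`-sets of the pentagon SHARING a vertex have no common non-trivial symmetry in
# `D₅`; hence the freeness hypothesis of the dihedral-decic menu holds for two distinct types sharing a `τ`-embedding (census and realised levels)

Cell `pub-hodgecm2` (COR-CM), seat b30 gen 42 (2026-08-26); count-neutral own lane MULTI-FIELD WEIL ENGINE (stem `MultiFieldWeil*`), the sequel of
`CorCM/MultiFieldWeilDihedralImage.lean` ∕ `…DihedralUnit.lean` making the hypothesis `hfree` of `CorCM/MultiFieldWeilDihedralDecics{,Grouped,Showcase}.lean` CHECKABLE BY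
INSPECTION.  Theorems only; no definition, no named fact, no `sorry`, no `decide` beyond numerals of `Fin 5`.  HONEST FRAMING: finite group theory and Galois bookkeeping; `HC_CM` is
NOT touched.

* §1 `addRight_stab_pair` (a rotation of `ℤ/5` stabilising a `2`-set is the identity), `subLeft_stab_pair` (the reflection `x ↦ t − x` stabilises `{a, b}` iff `t = a + b`),
  `conj_dihedral_exhaust` (under the hypotheses of `exists_conj_dihedral` the ten maps `g(x ↦ x+t)g⁻¹`, `g(x ↦ t−x)g⁻¹` EXHAUST `H`), and **`eq_one_of_stab_meeting_pairs`**: `H ⊆ Sym(5)`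
  closed, transitive, `|H| ≤ 10`, with a non-identity element fixing a letter; if `σ ∈ H` stabilises two DISTINCT `2`-sets that SHARE a letter, then `σ = 1` — i.e. the hypothesis
  `hfree` of `const_of_signed_of_dihedral_image` holds for such pairs.
* §2 **`eq_one_of_stab_meeting_realisedTuples`** (realised): for a slot `m₀` with five letters over `k` imaginary quadratic, `[L(K_{m₀}) : ℚ] ≤ 20` and a `τ`-embedding value
  outside the image of another, a realised tuple stabilising two distinct meeting `2`-sets of letters is the identity at `m₀` — the hypothesis `hfree` of
  `const_of_signed_realisedTuples_of_dihedral`; **`const_of_signed_realisedTuples_of_dihedral_meet`**: that theorem with `hfree` replaced by «distinct and sharing a letter».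
[cite: DixonMortimer1996, §1.4 Ex. 1.4.1–1.4.2; §1.6, Thm. 1.6A; §2.1; §3.3] [cite: Serre1977, §5.3] [cite: Lang2002, VI §1 Thm. 1.1; I §6] [cite: Shimura1998, §18.2 Lemma (i)]

## References
* [DixonMortimer1996] J. D. Dixon, B. Mortimer, *Permutation Groups*, GTM 163, §1.4, §1.6 (Thm. 1.6A), §2.1, §3.3.  [Serre1977] J.-P. Serre, *Linear Representations of Finite
  Groups*, GTM 42, §5.3.  [Lang2002] S. Lang, *Algebra*, GTM 211, I §6, VI §1.  [Shimura1998] G. Shimura, *Abelian varieties with complex multiplication and modular functions*, §18.2.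
-/

noncomputable section

open IntermediateField NumberField

namespace Summit.HodgeConjecture.CorCM.MultiFieldWeil

open Finset
open Fin.CommRing
open Summit.HodgeConjecture.CorCM.Census.MultiFieldWeil

open scoped Classical

/-! ## §1 Two distinct `2`-sets sharing a vertex have no common non-trivial symmetry -/

section Census

/-- **A rotation of `ℤ/5` stabilising a `2`-set is the identity.** [folklore] -/
theorem addRight_stab_pair (t : Fin 5) {Q : Finset (Fin 5)} (hQ : Q.card = 2) (h : ∀ x, x + t ∈ Q ↔ x ∈ Q) : t = 0 := by
  obtain ⟨a, b, hab, rfl⟩ := Finset.card_eq_two.1 hQ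
  have ha := (h a).2 (by simp)
  simp only [Finset.mem_insert, Finset.mem_singleton] at ha
  rcases ha with ha | ha
  · linear_combination ha
  · have hb := (h b).2 (by simp)
    simp only [Finset.mem_insert, Finset.mem_singleton] at hb
    rcases hb with hb | hb
    · -- `a + t = b`, `b + t = a`: `2t = 0`
      have h2 : 2 * t = 0 := by linear_combination ha + hb
      linear_combination 3 * h2 - t * five_eq_zero_fin
    · linear_combination hb

/-- **The reflection `x ↦ t − x` stabilises `{a, b}` (`a ≠ b`) only if `t = a + b`.** [folklore] -/
theorem subLeft_stab_pair (t : Fin 5) {a b : Fin 5} (hab : a ≠ b) (h : ∀ x, t - x ∈ ({a, b} : Finset (Fin 5)) ↔ x ∈ ({a, b} : Finset (Fin 5))) : t = a + b := by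
  have ha := (h a).2 (by simp)
  have hb := (h b).2 (by simp)
  simp only [Finset.mem_insert, Finset.mem_singleton] at ha hb
  rcases ha with ha | ha
  · rcases hb with hb | hb
    · linear_combination hb
    · exfalso; apply hab
      have h2 : 2 * (a - b) = 0 := by linear_combination -ha + hb
      linear_combination 3 * h2 - (a - b) * five_eq_zero_fin
  · linear_combination ha

variable {H : Finset (Equiv.Perm (Fin 5))}

/-- **The ten conjugated dihedral maps exhaust `H`.**  Under the hypotheses of `exists_conj_dihedral` (closed, transitive, `|H| ≤ 10`, a non-identity element fixing a letter) every
element of `H` is `g (x ↦ x + t) g⁻¹` or `g (x ↦ t − x) g⁻¹` for the frame `g`. [cite: DixonMortimer1996, §1.6, Thm. 1.6A; §3.3] -/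
theorem conj_dihedral_exhaust (hcard : H.card ≤ 10) (g : Equiv.Perm (Fin 5))
    (hg : ∀ t : Fin 5, g * Equiv.addRight t * g⁻¹ ∈ H ∧ g * Equiv.subLeft t * g⁻¹ ∈ H) (σ : Equiv.Perm (Fin 5)) (hσ : σ ∈ H) :
    ∃ t : Fin 5, σ = g * Equiv.addRight t * g⁻¹ ∨ σ = g * Equiv.subLeft t * g⁻¹ := by
  set F : Fin 5 × Bool → Equiv.Perm (Fin 5) := fun p => if p.2 then g * Equiv.subLeft p.1 * g⁻¹ else g * Equiv.addRight p.1 * g⁻¹ with hF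
  have hconj : ∀ ρ ρ' : Equiv.Perm (Fin 5), g * ρ * g⁻¹ = g * ρ' * g⁻¹ → ρ = ρ' := fun ρ ρ' h => by
    have := congrArg (fun π => g⁻¹ * π * g) h
    simpa [mul_assoc] using this
  have hFinj : Function.Injective F := by
    rintro ⟨t, b⟩ ⟨t', b'⟩ h
    cases b <;> cases b' <;> simp only [hF, if_true, Bool.false_eq_true, if_false] at h
    · have h0 := congrArg (fun π : Equiv.Perm (Fin 5) => π 0) (hconj _ _ h)
      simp only [Equiv.coe_addRight, zero_add] at h0
      rw [h0]
    · exfalso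
      have h1 := hconj _ _ h
      have h0 := congrArg (fun π : Equiv.Perm (Fin 5) => π 0) h1
      have h1' := congrArg (fun π : Equiv.Perm (Fin 5) => π 1) h1
      simp only [Equiv.coe_addRight, zero_add, Equiv.subLeft_apply, sub_zero] at h0 h1'
      have : (2 : Fin 5) = 0 := by linear_combination h1' - h0
      exact absurd this (by decide)
    · exfalso
      have h1 := hconj _ _ h
      have h0 := congrArg (fun π : Equiv.Perm (Fin 5) => π 0) h1
      have h1' := congrArg (fun π : Equiv.Perm (Fin 5) => π 1) h1
      simp only [Equiv.coe_addRight, zero_add, Equiv.subLeft_apply, sub_zero] at h0 h1'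
      have : (2 : Fin 5) = 0 := by linear_combination h0 - h1'
      exact absurd this (by decide)
    · have h0 := congrArg (fun π : Equiv.Perm (Fin 5) => π 0) (hconj _ _ h)
      simp only [Equiv.subLeft_apply, sub_zero] at h0
      rw [h0]
  have hSH : Finset.univ.image F = H := by
    refine Finset.eq_of_subset_of_card_le (fun π hπ => ?_) ?_
    · obtain ⟨⟨t, b⟩, -, rfl⟩ := Finset.mem_image.1 hπ
      cases b
      · simp only [hF, Bool.false_eq_true, if_false]; exact (hg t).1
      · simp only [hF, if_true]; exact (hg t).2
    · rw [Finset.card_image_of_injective _ hFinj, Finset.card_univ, Fintype.card_prod, Fintype.card_fin, Fintype.card_bool]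
      exact hcard
  rw [← hSH] at hσ
  obtain ⟨⟨t, b⟩, -, rfl⟩ := Finset.mem_image.1 hσ
  cases b
  · exact ⟨t, Or.inl (by simp only [hF, Bool.false_eq_true, if_false])⟩
  · exact ⟨t, Or.inr (by simp only [hF, if_true])⟩

/-- **TWO DISTINCT `2`-SETS SHARING A LETTER HAVE NO COMMON NON-TRIVIAL SYMMETRY IN A DIHEDRAL IMAGE.**  `H ⊆ Sym(5)` closed under products and inverses, transitive, `|H| ≤ 10`,
with a non-identity element fixing a letter (so `H = g D₅ g⁻¹`); `σ ∈ H` stabilising every `Q_l` (`2`-sets), two of which are distinct and meet ⟹ `σ = 1` (rotations stabilise no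
`2`-set; the reflection of axis `t` stabilises only the disjoint pairs `{a, t − a}`).  This is the hypothesis `hfree` of `const_of_signed_of_dihedral_image` for such families.
[cite: DixonMortimer1996, §1.6, Thm. 1.6A; §2.1; §3.3] [cite: Serre1977, §5.3] -/
theorem eq_one_of_stab_meeting_pairs {ι : Type} (hmul : ∀ σ ∈ H, ∀ σ' ∈ H, σ * σ' ∈ H) (hinv : ∀ σ ∈ H, σ⁻¹ ∈ H) (hne : H.Nonempty) (hcard : H.card ≤ 10)
    (htrans : ∀ a b : Fin 5, ∃ σ ∈ H, σ a = b) (hfix : ∃ σ ∈ H, σ ≠ 1 ∧ ∃ a, σ a = a)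
    (Q : ι → Finset (Fin 5)) (hQ : ∀ l, (Q l).card = 2) {i j : ι} (hij : Q i ≠ Q j) (hmeet : (Q i ∩ Q j).Nonempty)
    (σ : Equiv.Perm (Fin 5)) (hσ : σ ∈ H) (hstab : ∀ (l : ι) (x : Fin 5), σ x ∈ Q l ↔ x ∈ Q l) : σ = 1 := by
  obtain ⟨g, hg⟩ := exists_conj_dihedral hmul hinv hne hcard htrans hfix
  -- the transported sets
  set Q' : ι → Finset (Fin 5) := fun l => (Q l).image ⇑g⁻¹ with hQ'
  have hmemQ' : ∀ (l : ι) (y : Fin 5), y ∈ Q' l ↔ g y ∈ Q l := fun l y => by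
    rw [hQ', Finset.mem_image]
    constructor
    · rintro ⟨x, hx, rfl⟩; simpa using hx
    · intro hy; exact ⟨g y, hy, by simp⟩
  have hQ'card : ∀ l, (Q' l).card = 2 := fun l => by rw [hQ', Finset.card_image_of_injective _ g⁻¹.injective, hQ l]
  have hij' : Q' i ≠ Q' j := fun h => hij (by
    have := congrArg (Finset.image ⇑g) h
    simpa [hQ', Finset.image_image] using this)
  have hmeet' : (Q' i ∩ Q' j).Nonempty := by
    obtain ⟨c, hc⟩ := hmeet
    rw [Finset.mem_inter] at hc
    refine ⟨g⁻¹ c, Finset.mem_inter.2 ⟨?_, ?_⟩⟩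
    · rw [hmemQ']; simpa using hc.1
    · rw [hmemQ']; simpa using hc.2
  obtain ⟨t, ht | ht⟩ := conj_dihedral_exhaust hcard g hg σ hσ
  · -- a rotation stabilising `Q' i`: `t = 0`
    have hst : ∀ y : Fin 5, y + t ∈ Q' i ↔ y ∈ Q' i := fun y => by
      rw [hmemQ', hmemQ']
      have := hstab i (g y)
      rw [ht] at this
      simpa [Equiv.Perm.mul_apply] using this
    have h0 := addRight_stab_pair t (hQ'card i) hst
    rw [ht, h0]
    exact Equiv.ext fun x => by simp
  · -- a reflection stabilising both: the axes agree, contradiction with sharing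
    exfalso
    have hstr : ∀ (l : ι) (y : Fin 5), t - y ∈ Q' l ↔ y ∈ Q' l := fun l y => by
      rw [hmemQ', hmemQ']
      have := hstab l (g y)
      rw [ht] at this
      simpa [Equiv.Perm.mul_apply] using this
    obtain ⟨a, b, hab, hiab⟩ := Finset.card_eq_two.1 (hQ'card i)
    obtain ⟨a', b', hab', hjab⟩ := Finset.card_eq_two.1 (hQ'card j)
    have hti : t = a + b := subLeft_stab_pair t hab (fun y => by rw [← hiab]; exact hstr i y)
    have htj : t = a' + b' := subLeft_stab_pair t hab' (fun y => by rw [← hjab]; exact hstr j y)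
    obtain ⟨c, hc⟩ := hmeet'
    rw [Finset.mem_inter, hiab, hjab] at hc
    simp only [Finset.mem_insert, Finset.mem_singleton] at hc
    apply hij'
    rw [hiab, hjab]
    obtain ⟨hc1, hc2⟩ := hc
    rcases hc1 with rfl | rfl <;> rcases hc2 with h | h
    · have : b = b' := by linear_combination -hti + htj - h
      rw [h, this]
    · have : b = a' := by linear_combination -hti + htj - h
      rw [h, this, Finset.pair_comm]
    · have : a = b' := by linear_combination -hti + htj - h
      rw [h, this, Finset.pair_comm]
    · have : a = a' := by linear_combination -hti + htj - h
      rw [h, this]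

end Census

/-! ## §2 The realised reading -/

section Realised

variable {I : Type} {r : ℕ} {Kf : I → Type} [∀ i, Field (Kf i)] [∀ i, NumberField (Kf i)] {i₀ : I} {is : Fin r → I} {n : Fin r → ℕ}
  {e : ∀ m : Fin r, (Kf (is m) →+* ℂ) ≃ Fin (n m) × Bool} {τ : Kf i₀ →+* ℂ} {im : ∀ m : Fin r, Kf i₀ →+* Kf (is m)}
  (he_sign : ∀ (m : Fin r) (s : Kf (is m) →+* ℂ), (e m s).2 = true ↔ s.comp (im m) = τ)

include he_sign in
/-- **A REALISED TUPLE STABILISING TWO DISTINCT MEETING `2`-SETS OF LETTERS OF A DIHEDRAL DECIC SLOT IS THE IDENTITY THERE** — the hypothesis `hfree` of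
`const_of_signed_realisedTuples_of_dihedral` from «distinct and sharing a letter»: the image at `m₀` is a transitive closed set of at most `10` permutations
(`card_image_realisedTuples_mul_le`) with a non-identity element fixing a letter (`exists_fix_ne_one_realisedTuples`), and `eq_one_of_stab_meeting_pairs` applies after relabelling by
`Fin (n m₀) ≃ Fin 5`. [cite: DixonMortimer1996, §1.6, Thm. 1.6A; §3.3] [cite: Lang2002, VI §1 Thm. 1.1; I §6] [cite: Shimura1998, §18.2 Lemma (i)] -/
theorem eq_one_of_stab_meeting_realisedTuples (m₀ : Fin r) (h5 : n m₀ = 5) (h2 : Module.finrank ℚ (Kf i₀) = 2)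
    (h20 : Module.finrank ℚ ↥(normalClosure ℚ (Kf (is m₀)) ℂ) ≤ 20)
    (hns : ∃ s₀ t₀ : Kf (is m₀) →+* ℂ, s₀.comp (im m₀) = τ ∧ t₀.comp (im m₀) = τ ∧ ∃ x, t₀ x ∉ adjoin ℚ (Set.range s₀))
    {ι : Type} (Q : ι → Finset (Fin (n m₀))) (hQ : ∀ l, (Q l).card = 2) {i j : ι} (hij : Q i ≠ Q j) (hmeet : (Q i ∩ Q j).Nonempty)
    (π : PermsG n) (hπ : π ∈ realisedTuples e τ) (hstab : ∀ (l : ι) (x : Fin (n m₀)), π m₀ x ∈ Q l ↔ x ∈ Q l) : π m₀ = 1 := by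
  set R := realisedTuples e τ with hR
  have hmul : ∀ π ∈ R, ∀ π' ∈ R, π * π' ∈ R := fun _ hπ _ hπ' => mul_mem_realisedTuples e τ hπ hπ'
  have hinv : ∀ π ∈ R, π⁻¹ ∈ R := fun _ hπ => inv_mem_realisedTuples hπ
  have hne : R.Nonempty := realisedTuples_nonempty (e := e) he_sign
  set H₀ : Finset (Equiv.Perm (Fin (n m₀))) := R.image fun π => π m₀ with hH₀
  have hmem₀ : ∀ σ, σ ∈ H₀ ↔ ∃ π ∈ R, π m₀ = σ := fun σ => Finset.mem_image
  set f : Fin (n m₀) ≃ Fin 5 := finCongr h5 with hf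
  set cj : Equiv.Perm (Fin (n m₀)) → Equiv.Perm (Fin 5) := fun σ => (f.symm.trans σ).trans f with hcj
  have hcj_apply : ∀ σ y, cj σ y = f (σ (f.symm y)) := fun σ y => rfl
  have hcj_mul : ∀ σ σ', cj (σ * σ') = cj σ * cj σ' := fun σ σ' => Equiv.ext fun y => by
    simp only [hcj_apply, Equiv.Perm.mul_apply, Equiv.symm_apply_apply]
  have hcj_one : cj 1 = 1 := Equiv.ext fun y => by simp only [hcj_apply, Equiv.Perm.one_apply, Equiv.apply_symm_apply]
  have hcj_inv : ∀ σ, cj σ⁻¹ = (cj σ)⁻¹ := fun σ => by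
    rw [eq_inv_iff_mul_eq_one, ← hcj_mul, inv_mul_cancel, hcj_one]
  have hcj_inj : Function.Injective cj := by
    intro σ σ' hσσ
    refine Equiv.ext fun x => ?_
    have := congrArg (fun π : Equiv.Perm (Fin 5) => π (f x)) hσσ
    simp only [hcj_apply, Equiv.symm_apply_apply] at this
    exact f.injective this
  set H : Finset (Equiv.Perm (Fin 5)) := H₀.image cj with hH
  have hmemH : ∀ σ₅, σ₅ ∈ H ↔ ∃ π ∈ R, cj (π m₀) = σ₅ := fun σ₅ => by
    rw [hH, Finset.mem_image]
    constructor
    · rintro ⟨σ, hσ, rfl⟩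
      obtain ⟨π, hπ, rfl⟩ := (hmem₀ σ).1 hσ
      exact ⟨π, hπ, rfl⟩
    · rintro ⟨π, hπ, rfl⟩
      exact ⟨π m₀, (hmem₀ _).2 ⟨π, hπ, rfl⟩, rfl⟩
  have hmulH : ∀ σ ∈ H, ∀ σ' ∈ H, σ * σ' ∈ H := by
    intro σ hσ σ' hσ'
    obtain ⟨π, hπ, rfl⟩ := (hmemH σ).1 hσ
    obtain ⟨π', hπ', rfl⟩ := (hmemH σ').1 hσ'
    exact (hmemH _).2 ⟨π * π', hmul _ hπ _ hπ', by rw [Pi.mul_apply, hcj_mul]⟩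
  have hinvH : ∀ σ ∈ H, σ⁻¹ ∈ H := by
    intro σ hσ
    obtain ⟨π, hπ, rfl⟩ := (hmemH σ).1 hσ
    exact (hmemH _).2 ⟨π⁻¹, hinv _ hπ, by rw [Pi.inv_apply, hcj_inv]⟩
  have hneH : H.Nonempty := by
    obtain ⟨π, hπ⟩ := hne
    exact ⟨cj (π m₀), (hmemH _).2 ⟨π, hπ, rfl⟩⟩
  have hcardH : H.card ≤ 10 := by
    have h1 : H.card ≤ H₀.card := Finset.card_image_le
    have hb : H₀.card * Module.finrank ℚ (Kf i₀) ≤ Module.finrank ℚ ↥(normalClosure ℚ (Kf (is m₀)) ℂ) :=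
      card_image_realisedTuples_mul_le (e := e) he_sign m₀ (by rw [h5]; norm_num)
    rw [h2] at hb
    omega
  have htransH : ∀ a b : Fin 5, ∃ σ ∈ H, σ a = b := by
    intro a b
    obtain ⟨π, hπ, hab⟩ := transitive_realisedTuples (e := e) he_sign m₀ (f.symm a) (f.symm b)
    exact ⟨cj (π m₀), (hmemH _).2 ⟨π, hπ, rfl⟩, by rw [hcj_apply, hab, Equiv.apply_symm_apply]⟩
  have hfixH : ∃ σ ∈ H, σ ≠ 1 ∧ ∃ a, σ a = a := by
    obtain ⟨s₀, t₀, hs₀, ht₀, x, hx⟩ := hns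
    obtain ⟨π, hπ, hπ1, hπa⟩ := exists_fix_ne_one_realisedTuples (e := e) he_sign m₀ hs₀ ht₀ hx
    refine ⟨cj (π m₀), (hmemH _).2 ⟨π, hπ, rfl⟩, fun h1 => hπ1 (hcj_inj (h1.trans hcj_one.symm)), f (e m₀ s₀).1, ?_⟩
    rw [hcj_apply, Equiv.symm_apply_apply, hπa]
  -- the transported sets and the stabilising element
  have hQ5 : ∀ l, ((Q l).image ⇑f).card = 2 := fun l => by rw [Finset.card_image_of_injective _ f.injective, hQ l]
  have hmemQ5 : ∀ (l : ι) (x : Fin (n m₀)), f x ∈ (Q l).image ⇑f ↔ x ∈ Q l := fun l x => by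
    rw [Finset.mem_image]
    constructor
    · rintro ⟨y, hy, hxy⟩; rwa [← f.injective hxy]
    · intro hx; exact ⟨x, hx, rfl⟩
  have hij5 : (Q i).image ⇑f ≠ (Q j).image ⇑f := fun h => hij (Finset.image_injective f.injective h)
  have hmeet5 : ((Q i).image ⇑f ∩ (Q j).image ⇑f).Nonempty := by
    obtain ⟨c, hc⟩ := hmeet
    rw [Finset.mem_inter] at hc
    exact ⟨f c, Finset.mem_inter.2 ⟨(hmemQ5 i c).2 hc.1, (hmemQ5 j c).2 hc.2⟩⟩
  have hstab5 : ∀ (l : ι) (y : Fin 5), cj (π m₀) y ∈ (Q l).image ⇑f ↔ y ∈ (Q l).image ⇑f := fun l y => by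
    have := hstab l (f.symm y)
    rw [← hmemQ5 l, ← hmemQ5 l, Equiv.apply_symm_apply] at this
    rwa [hcj_apply]
  have h1 := eq_one_of_stab_meeting_pairs hmulH hinvH hneH hcardH htransH hfixH (fun l => (Q l).image ⇑f) hQ5 hij5 hmeet5
    (cj (π m₀)) ((hmemH _).2 ⟨π, hπ, rfl⟩) hstab5
  exact hcj_inj (h1.trans hcj_one.symm)

include he_sign in
/-- **THE SEPARATION PROPERTY OF A DIHEDRAL DECIC UNIT, FREENESS FROM SHARING.**  `const_of_signed_realisedTuples_of_dihedral` with the hypothesis `hfree` replaced by: the (at most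
two) position sets are pairwise DISTINCT and SHARE a letter. [cite: DixonMortimer1996, §1.6, Thm. 1.6A; §3.3] [cite: Serre1977, §5.3] [cite: Lang2002, VI §1 Thm. 1.1; I §6]
[cite: Shimura1998, §18.2 Lemma (i)] -/
theorem const_of_signed_realisedTuples_of_dihedral_meet (m₀ : Fin r) (h5 : n m₀ = 5) (h2 : Module.finrank ℚ (Kf i₀) = 2)
    (h20 : Module.finrank ℚ ↥(normalClosure ℚ (Kf (is m₀)) ℂ) ≤ 20)
    (hns : ∃ s₀ t₀ : Kf (is m₀) →+* ℂ, s₀.comp (im m₀) = τ ∧ t₀.comp (im m₀) = τ ∧ ∃ x, t₀ x ∉ adjoin ℚ (Set.range s₀))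
    {ι : Type} [Fintype ι] (hι : Fintype.card ι ≤ 2) (Q : ι → Finset (Fin (n m₀))) (hQ : ∀ i, (Q i).card = 2)
    (hmeet : ∀ i j : ι, i ≠ j → Q i ≠ Q j ∧ (Q i ∩ Q j).Nonempty) (hι2 : ∃ i j : ι, i ≠ j)
    (u : ι → Fin (n m₀) → ℤ) {w : ℤ} (h : ∀ π ∈ realisedTuples e τ, (∑ i, ∑ x : Fin (n m₀), (if π m₀ x ∈ Q i then u i x else -u i x)) = w)
    (i : ι) (a b : Fin (n m₀)) : u i a = u i b := by
  obtain ⟨i₁, j₁, hij⟩ := hι2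
  exact const_of_signed_realisedTuples_of_dihedral (e := e) he_sign m₀ h5 h2 h20 hns hι Q hQ
    (fun π hπ hst => eq_one_of_stab_meeting_realisedTuples (e := e) he_sign m₀ h5 h2 h20 hns Q hQ (hmeet i₁ j₁ hij).1 (hmeet i₁ j₁ hij).2 π hπ hst) u h i a b

end Realised

end Summit.HodgeConjecture.CorCM.MultiFieldWeil

end
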